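import Summits.BirchSwinnertonDyer.Rank1Residual.Additive.TwistPartnerForcedCertificate
import Summits.BirchSwinnertonDyer.Rank1Residual.Additive.TameBranchKatoDivisibilityOfDelbourgo
import HarnessLib

/-!
# The per-pair JOIN on defect 3, 4, 6: ONE boundedness statement + ONE finite sum of `E`'s own
# twisted modular symbols ⟹ the λ-certificate, Schneider at `r_an = 1`, the valuation identity
# (cell `b2b-bsdres`, sub-cell additive-p2 = X3♯(G-ord) / X4♯(G-ord), gen 24; sequel of
# `TwistPartnerForcedCertificate.lean` and of `TameBranchKatoDivisibilityRankOne.lean` §6)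

HONEST FRAMING (cell `b2b-bsdres`, run/shared/lean/b2b/bsd-rank1-residual/, verbatim in every
file): the goal of the cell is to DELETE the COMBINATION-SHAPED residual classes of the
Birch–Swinnerton-Dyer formula for ALL analytic-rank `≤ 1` elliptic curves over `ℚ` — "full BSD
formula for every rank `≤ 1` curve in class `C`" assembled STRICTLY from published theorems — so
that the rank-`≤ 1` remainder becomes exactly the CONSTRUCTION-SHAPED classes, which are TYPED
(missing-input `Prop`s), NOT attempted. This is not "finishing BSD". Sub-cell additive-p2: the
classes X3♯(G-ord) / X4♯(G-ord) are CONSTRUCTION-SHAPED and stay so; labels / RESIDUAL-MAP marks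
UNCHANGED; nothing is booked. THEOREMS ONLY (no definition, no named fact, no conjecture node);
every unproved input — the typed Kato half `TameBranchRatDvdAt` (or the named facts Delbourgo 2002
(A), (A_M), (C) that discharge it: A175, A227), GZK, `PlusSymbolsPIntegralAt`, the boundedness of the
forced partner, the finite Riemann-sum equality `‖RS k n‖ = 1` — is an explicit hypothesis
(referee-1 rule R1). An instrument's Riemann sum (`HOME/b2b-bsdres-additive-p2/gen23/ENGINE-FORCED-PARTNER.md`
§4: 13 Gord_e346 rows; gen 24 `gen24/`) is EVIDENCE for the last hypothesis, never a proof of it.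

## What

On the X4-3 locus (`p ≥ 5`, `E = W` additive at `p`, `SubGord`, defect `e ∈ {3,4,6}`), for a
newform `f` of `E`, the Teichmüller power `χ = ω^{t(E,p)}` and a unit `ã`, PER PAIR (no
`OrdinaryTwistPartnerAt`, no `∃` over functions, no `∀ (ã, B)`-quantified certificate):
* `exists_isTameBranchOf_forcedRiemannSum_of_isTeichmullerPow` — boundedness of the forced partner
  `forced χ [·]⁺_f ã` (gen 23's ONE typed analytic input, `hasOrdinaryTwistPartner_iff_of_addv`)
  gives the E-normalised tame branch `IsTameBranchOf f p (ι∘χ) ã B` with `orderOf (ι∘χ) = e`, the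
  integrality transfer and the truncation bound `‖[T^k]B − RS k n‖ ≤ (C/‖k!‖)·p⁻ⁿ` against the
  Riemann sums of the explicit measure `μ(a + p^{n+1}ℤ_p) = ã^{−(n+1)}χ̄(a)Φ(a/p^{n+1})`
  (`TwistPartnerForcedCertificate.lean`);
* `charLamLeAt_of_tameBranchRatDvdAt_of_forcedRiemannSum` — THE JOIN: typed Kato half
  `TameBranchRatDvdAt W p` + `PlusSymbolsPIntegralAt W p` + that bound + `‖RS k n‖ = 1` (`k < p`,
  `n ≥ 1`) ⟹ `CharLamLeAt W p k` (n1011-p01's λ-certificate); the `∀ (ã, B)`-quantified certificate of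
  gen 20's `charLamLeAt_of_tameBranchRatDvdAt_of_ordinaryTwistPartnerAt` is ONE number here;
* `exists_schneider_rankOne_of_tameBranchRatDvdAt_of_forcedRiemannSum` — at `ord_{s=1}L(E,s) = 1`,
  non-CM, with A175 (Delbourgo 2002 (A)+(B)) and GZK: Schneider `Reg_p(E,Dh) ≠ 0` for EVERY height
  datum with the (B)-clauses, and one exists;
* `padicVal_identity_rankOne_of_tameBranchRatDvdAt_of_forcedRiemannSum` — per cyclotomic datum:
  `λ = 1`, `#Ш[p^∞] < ∞`, `ord Ш[p^∞] + ord Reg_p + ord ∏c + ord ℓ = μ + 1 + 2·ord #tors`;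
* `charLamLeAt_of_thmC_of_forcedRiemannSum`, `exists_schneider_rankOne_of_thmC_of_forcedRiemannSum` —
  the same with the typed Kato half DISCHARGED by Delbourgo 2002 (C) (A227, `tameBranchRatDvdAt_of_thmC`).
For the 13 Gord_e346 window rows of gen 23's engine (EVIDENCE, one engine), the hypothesis
`‖RS 1 n‖ = 1` is what the 8 rows with `v_p([T¹]B·log_p γ) = 1` exhibit
(`RS 1 n·log_p γ ≡ ∑_a log_p(a)μ(a + p^{n+1}ℤ_p)`); the 5 rows with `v ≥ 2` are NOT unit-certified.

What is NOT claimed: boundedness of the forced partner (Manin–Drinfeld for `f̃`; the typed input),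
`PlusSymbolsPIntegralAt` off the surjective rows, any `μ`-statement, the lower half, any booking.

References: D. Delbourgo, J. Number Theory 95 (2002) Thm. (A)–(C) p. 40 [Delbourgo2002]; B. Mazur,
J. Tate, J. Teitelbaum, Invent. Math. 84 (1986) §I.10, §I.14 (14.3) [MazurTateTeitelbaum1986Invent];
W. Stein, C. Wuthrich, Math. Comp. 82 (2013) §3 [SteinWuthrich2013]; D. Delbourgo, Compositio Math.
113 (1998) §1.5 [Delbourgo1998]; L. Washington, GTM 83 §7.1 [Washington1997];
HOME/b2b-bsdres-additive-p2/gen23/ENGINE-FORCED-PARTNER.md (EVIDENCE).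
-/

noncomputable section

open scoped Classical MatrixGroups ModularForm NumberField

open CongruenceSubgroup WeierstrassCurve NumberField Literature.NumberTheory.EllipticCurves
  Literature.NumberTheory.EllipticCurves.ModularForms
  Literature.NumberTheory.EllipticCurves.Rank1Residual
  Literature.NumberTheory.EllipticCurves.Rank1Residual.Typed
  Literature.NumberTheory.EllipticCurves.Delbourgo2002
  Summit.BirchSwinnertonDyer.Rank1Residual.X1.MuLambda
  Summit.BirchSwinnertonDyer.Rank1Residual.X11a.LambdaNorm

namespace Summit.BirchSwinnertonDyer.Rank1Residual.Additive

/-! ### §3 Curve level, the X4-3 locus (defect `3, 4, 6`): the per-pair JOIN -/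

section Curve

variable {W : WeierstrassCurve ℚ} [W.IsElliptic] [W.IsGloballyMinimal] {p : ℕ} [hp : Fact p.Prime]
  {N : ℕ} [NeZero N] {f : CuspForm (Gamma0 N) 2} {χ : MulChar (ZMod p) ℚ_[p]} {ã : ℚ_[p]}
  {RS : ℕ → ℕ → ℚ_[p]}
  (hRS : ∀ k n : ℕ, RS k n =
      ∑ᶠ ξ : rootsOfUnity (Literature.NumberTheory.EllipticCurves.torsionOrder p) ℤ_[p],
        ∑ s : ZMod (p ^ n),
        twistPartnerMeasure χ
            (TwistPartner.forced χ (fun r ↦ ((ratPlusSymbol f r : ℚ) : ℚ_[p])) ã) ã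
            ((ratPlusSymbol f 0 : ℚ) : ℚ_[p]) (n + cyclotomicExponent p)
            (PadicInt.toZModPow (n + cyclotomicExponent p) ((ξ : ℤ_[p]ˣ) : ℤ_[p]) *
              (cyclotomicGenerator p : ZMod (p ^ (n + cyclotomicExponent p))) ^ s.val) *
          ((s.val.choose k : ℕ) : ℚ_[p]))

include hRS

/-- **Per pair on the X4-3 locus: the forced tame branch for `χ = ω^{t(E,p)}` has the tame character of
order EXACTLY `e = tameDefect E p`, the integrality transfer and the truncation bound.** `p ≥ 5`,
`E = W` additive at `p`, `SubGord`, `e ∈ {3,4,6}`, `f` a newform of `E`, `χ` the Teichmüller power of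
exponent `t(E,p)` (hence `χ ≠ 1`), `‖ã‖ = 1`, the forced partner bounded (`U_p f_E = 0` is automatic).
No `OrdinaryTwistPartnerAt`, no `∃` over functions. [cite: MazurTateTeitelbaum1986Invent, §I.14 (14.3)]
[cite: Delbourgo1998, §1.5] -/
theorem exists_isTameBranchOf_forcedRiemannSum_of_isTeichmullerPow (h5 : 5 ≤ p) (hadd : Addv W p)
    (hG : SubGord W p) (he : semistabilityIndex W p ∈ ({3, 4, 6} : Finset ℕ)) (hf : IsNewformOf W f)
    (hχ : CensusX43.IsTeichmullerPow χ (CensusX43.ordinaryTeichmullerExponent W p)) (hã : ‖ã‖ = 1)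
    {C₀ : ℝ}
    (hC₀ : ∀ s, ‖TwistPartner.forced χ (fun r ↦ ((ratPlusSymbol f r : ℚ) : ℚ_[p])) ã s‖ ≤ C₀) :
    ∃ B : PowerSeries ℚ_[p],
      orderOf (χ.ringHomComp (algebraMap ℚ_[p] ℂ_[p])) = tameDefect W p ∧
      IsTameBranchOf f p (χ.ringHomComp (algebraMap ℚ_[p] ℂ_[p])) ã B ∧
      (∀ C : ℝ, (∀ r : ℚ, ‖((ratPlusSymbol f r : ℚ) : ℚ_[p])‖ ≤ C) →
        ∀ n : ℕ, ‖PowerSeries.coeff n B‖ ≤ C) ∧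
      ∀ C : ℝ, (∀ r : ℚ, ‖((ratPlusSymbol f r : ℚ) : ℚ_[p])‖ ≤ C) →
        ∀ k n : ℕ, ‖PowerSeries.coeff k B - RS k n‖ ≤
          C / ‖((k.factorial : ℕ) : ℚ_[p])‖ * (p : ℝ) ^ (-n : ℤ) := by
  have hne : χ ≠ 1 := CensusX43.ne_one_of_isTeichmullerPow hχ
    (CensusX43.not_dvd_ordinaryTeichmullerExponent W p h5 he hG.2.2)
  obtain ⟨B, hB, hint, hRSle⟩ := exists_isTameBranchOf_riemannSum_of_bounded_forced hRS hne hã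
    (sum_ratPlusSymbol_add_div_eq_zero_of_addv W hf hadd) hC₀
  refine ⟨B, ?_, hB, hint, hRSle⟩
  rw [orderOf_ringHomComp_padicComplex, orderOf_eq_of_isTeichmullerPow hχ,
    div_gcd_ordinaryTeichmullerExponent_eq W p he hG.2.2, tameDefect_of_not_potMult W p hG.1]

/-- **THE JOIN (λ-certificate).** On the X4-3 locus (`p ≥ 5`, `E = W` additive at `p`, `SubGord`,
`e ∈ {3,4,6}`), for a newform `f` of `E`, `χ = ω^{t(E,p)}` and a unit `ã`: the typed Kato half
`TameBranchRatDvdAt W p` + `PlusSymbolsPIntegralAt W p` + boundedness of the forced partner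
`forced χ [·]⁺_f ã` (the ONE typed analytic input, `hasOrdinaryTwistPartner_iff_of_addv`) + ONE finite
Riemann sum with `‖RS k n‖_p = 1` (`k < p`, `n ≥ 1`) ⟹ `CharLamLeAt W p k` (every Selmer dual datum
over `ℚ_∞` is `Λ`-torsion with `μ(char) = 0 → λ(char) ≤ k`, n1011-p01). The `∀ (ã, B)`-quantified
certificate of `charLamLeAt_of_tameBranchRatDvdAt_of_ordinaryTwistPartnerAt` (gen 20) is ONE number
here. [cite: Delbourgo2002, Theorem (C) (p. 40)] [cite: SteinWuthrich2013, §3] -/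
theorem charLamLeAt_of_tameBranchRatDvdAt_of_forcedRiemannSum (hT : TameBranchRatDvdAt W p)
    (hPI : PlusSymbolsPIntegralAt W p) (h5 : 5 ≤ p) (hadd : Addv W p) (hG : SubGord W p)
    (he : semistabilityIndex W p ∈ ({3, 4, 6} : Finset ℕ)) (hf : IsNewformOf W f)
    (hχ : CensusX43.IsTeichmullerPow χ (CensusX43.ordinaryTeichmullerExponent W p)) (hã : ‖ã‖ = 1)
    {C₀ : ℝ}
    (hC₀ : ∀ s, ‖TwistPartner.forced χ (fun r ↦ ((ratPlusSymbol f r : ℚ) : ℚ_[p])) ã s‖ ≤ C₀)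
    {k n : ℕ} (hk : k < p) (hn : 1 ≤ n) (hunit : ‖RS k n‖ = 1) : CharLamLeAt W p k := by
  have hne : χ ≠ 1 := CensusX43.ne_one_of_isTeichmullerPow hχ
    (CensusX43.not_dvd_ordinaryTeichmullerExponent W p h5 he hG.2.2)
  obtain ⟨B, hord, hB, hint, -⟩ :=
    exists_isTameBranchOf_forcedRiemannSum_of_isTeichmullerPow hRS h5 hadd hG he hf hχ hã hC₀
  have hp2 : p ≠ 2 := by omega
  have hne2 : semistabilityIndex W p ≠ 2 := by
    simp only [Finset.mem_insert, Finset.mem_singleton] at he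
    omega
  have hGord : TypeGOrd W p :=
    (typeGOrd_iff_typeG_of_semistabilityIndex_ne_two W p h5 hadd hne2).mpr
      ((subGord_iff_typeG_of_addv W p hp2 hadd).mp hG)
  have hint1 : ∀ j : ℕ, ‖PowerSeries.coeff j B‖ ≤ 1 := hint 1 (hPI f hf)
  have hunit' : ‖PowerSeries.coeff k B‖ = 1 :=
    hB.norm_coeff_eq_one_of_forcedRiemannSum hRS hne hã
      (sum_ratPlusSymbol_add_div_eq_zero_of_addv W hf hadd) hC₀ (hPI f hf) hk hn hunit
  exact charLamLeAt_of_tameBranchRatDvdAt_of_integral_of_norm_coeff_eq_one hT hp2 hadd (Or.inr hGord)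
    hf hord hã hB hint1 hunit'

/-- **X4-3 locus, `ord_{s=1} L(E,s) = 1`, non-CM: SCHNEIDER FOR DELBOURGO'S DATUM from one finite
sum.** Typed Kato half + `PlusSymbolsPIntegralAt` + boundedness of the forced partner + the level-`n`
Riemann sum of index `1` a `p`-adic unit (`n ≥ 1`) + A175 (Delbourgo 2002 (A)+(B), `hDel`) + GZK ⟹
`Reg_p(E, Dh) ≠ 0` for EVERY height datum with the (B)-clauses, and one such datum exists. The
rank-one typeG statement of `exists_schneider_rankOne_of_tameBranchRatDvdAt_of_ordinaryTwistPartnerAt`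
(gen 20) with its `∀`-certificate replaced by ONE number. Nothing booked.
[cite: Delbourgo2002, Theorem (A), (B), (C) (p. 40)] [cite: SteinWuthrich2013, §3] -/
theorem exists_schneider_rankOne_of_tameBranchRatDvdAt_of_forcedRiemannSum
    (hDel : Delbourgo2002.mainTheorem) (hGZK : rank_eq_analyticRank_of_analyticRank_le_one)
    (hT : TameBranchRatDvdAt W p) (hPI : PlusSymbolsPIntegralAt W p) (h5 : 5 ≤ p) (hcm : ¬ W.HasCM)
    (hadd : Addv W p) (hG : SubGord W p) (he : semistabilityIndex W p ∈ ({3, 4, 6} : Finset ℕ))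
    (hr : W.analyticRank = 1) (hf : IsNewformOf W f)
    (hχ : CensusX43.IsTeichmullerPow χ (CensusX43.ordinaryTeichmullerExponent W p)) (hã : ‖ã‖ = 1)
    {C₀ : ℝ}
    (hC₀ : ∀ s, ‖TwistPartner.forced χ (fun r ↦ ((ratPlusSymbol f r : ℚ) : ℚ_[p])) ã s‖ ≤ C₀)
    {n : ℕ} (hn : 1 ≤ n) (hunit : ‖RS 1 n‖ = 1) :
    (∀ Dh : PAdicHeightData W p, LeadingTermClauses W p Dh → SchneiderConjecture Dh) ∧
      ∃ Dh : PAdicHeightData W p, LeadingTermClauses W p Dh ∧ SchneiderConjecture Dh := by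
  have hp2 : p ≠ 2 := by omega
  have hne2 : semistabilityIndex W p ≠ 2 := by
    simp only [Finset.mem_insert, Finset.mem_singleton] at he
    omega
  have hGord : TypeGOrd W p :=
    (typeGOrd_iff_typeG_of_semistabilityIndex_ne_two W p h5 hadd hne2).mpr
      ((subGord_iff_typeG_of_addv W p hp2 hadd).mp hG)
  obtain ⟨hmw, -⟩ := hGZK W (by rw [hr])
  have hr1 : W.mordellWeilRank = 1 := by rw [hmw, hr]
  have hlam : CharLamLeAt W p W.mordellWeilRank := by
    rw [hr1]
    exact charLamLeAt_of_tameBranchRatDvdAt_of_forcedRiemannSum hRS hT hPI h5 hadd hG he hf hχ hã hC₀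
      (by omega) hn hunit
  have hA : ∀ (κ : ZpExtension ℚ p) (γ : Field.absoluteGaloisGroup ℚ),
      κ.IsCyclotomic → κ.IsTopGenerator γ → ∀ D : W.SelmerDualData κ γ, D.IsTorsion :=
    fun _ _ hκ hγ D ↦ Delbourgo2002.mainTheorem.isTorsion hDel h5 hcm hadd hGord hκ hγ D
  have hS : ∀ Dh : PAdicHeightData W p, LeadingTermClauses W p Dh → SchneiderConjecture Dh :=
    fun Dh hBcl ↦ (schneider_and_finite_of_charLamLe W p hBcl hA hlam).1
  obtain ⟨Dh, hBcl⟩ := Delbourgo2002.mainTheorem.exists_leadingTermClauses hDel h5 hcm hadd hGord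
  exact ⟨hS, Dh, hBcl, hS Dh hBcl⟩

/-- **X4-3 locus, rank one: THE VALUATION IDENTITY at a pair certified by one finite sum** (per
cyclotomic datum, `μ` carried). Same inputs as the λ-certificate, `rank_ℤ E(ℚ) = 1`, A175 (B) for the
height datum `Dh`: `X(E/ℚ_∞)` is `Λ`-torsion with generator `fE`, `λ(fE) = 1`, Schneider, `#Ш[p^∞] < ∞`,
and `ord_p #Ш(E)[p^∞] + ord_p Reg_p(E,Dh) + ord_p ∏c_ℓ + ord_p ℓ = μ(fE) + 1 + 2·ord_p #E(ℚ)_tors`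
(`ℓ ∣ p²`, `= 1` off the anomalous rows) — gen 20's `padicVal_identity_of_tameBranchRatDvdAt_of_cert`
with the tuple produced and certified from the forced partner. `BSD(E,p)` at such a pair reads
"`μ(X(E/ℚ_∞)) = ord_p(ℓ·Reg_p(Dh)·L'(E,1)/(Ω_E·Reg_∞)) − 1`". Nothing booked.
[cite: Delbourgo2002, Theorem (B), (C) (p. 40)] [cite: Washington1997, §7.1] -/
theorem padicVal_identity_rankOne_of_tameBranchRatDvdAt_of_forcedRiemannSum
    (hT : TameBranchRatDvdAt W p) (hPI : PlusSymbolsPIntegralAt W p) (h5 : 5 ≤ p)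
    (hadd : Addv W p) (hG : SubGord W p) (he : semistabilityIndex W p ∈ ({3, 4, 6} : Finset ℕ))
    (hrk : W.mordellWeilRank = 1) (hf : IsNewformOf W f)
    (hχ : CensusX43.IsTeichmullerPow χ (CensusX43.ordinaryTeichmullerExponent W p)) (hã : ‖ã‖ = 1)
    {C₀ : ℝ}
    (hC₀ : ∀ s, ‖TwistPartner.forced χ (fun r ↦ ((ratPlusSymbol f r : ℚ) : ℚ_[p])) ã s‖ ≤ C₀)
    {n : ℕ} (hn : 1 ≤ n) (hunit : ‖RS 1 n‖ = 1)
    {Dh : PAdicHeightData W p} (hBcl : LeadingTermClauses W p Dh)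
    {κ : ZpExtension ℚ p} {γ : Field.absoluteGaloisGroup ℚ}
    (hκ : κ.IsCyclotomic) (hγ : κ.IsTopGenerator γ) (hcv : IsCyclotomicVariable p γ)
    (D : W.SelmerDualData κ γ) [Module.Finite (IwasawaAlgebra p) D.X]
    {fE : IwasawaAlgebra p} (hchar : D.charIdeal = Ideal.span {fE}) :
    SchneiderConjecture Dh ∧ Finite (AddCommGroup.primaryComponent W.sha p) ∧
      lam fE = 1 ∧
      ∃ ℓ : ℕ, ℓ ∣ p ^ 2 ∧ (ReductionNonAnomalous W p → ℓ = 1) ∧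
        (padicValNat p (Nat.card (AddCommGroup.primaryComponent W.sha p)) : ℤ) +
            (padicRegulator Dh).valuation + padicValNat p W.tamagawaProduct + padicValNat p ℓ =
          mu fE + 1 + 2 * padicValNat p W.torsionOrder := by
  have hne : χ ≠ 1 := CensusX43.ne_one_of_isTeichmullerPow hχ
    (CensusX43.not_dvd_ordinaryTeichmullerExponent W p h5 he hG.2.2)
  obtain ⟨B, hord, hB, hint, -⟩ :=
    exists_isTameBranchOf_forcedRiemannSum_of_isTeichmullerPow hRS h5 hadd hG he hf hχ hã hC₀
  have hp2 : p ≠ 2 := by omega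
  have hne2 : semistabilityIndex W p ≠ 2 := by
    simp only [Finset.mem_insert, Finset.mem_singleton] at he
    omega
  have hGord : TypeGOrd W p :=
    (typeGOrd_iff_typeG_of_semistabilityIndex_ne_two W p h5 hadd hne2).mpr
      ((subGord_iff_typeG_of_addv W p hp2 hadd).mp hG)
  have hint1 : ∀ j : ℕ, ‖PowerSeries.coeff j B‖ ≤ 1 := hint 1 (hPI f hf)
  have hunit' : ‖PowerSeries.coeff 1 B‖ = 1 :=
    hB.norm_coeff_eq_one_of_forcedRiemannSum hRS hne hã
      (sum_ratPlusSymbol_add_div_eq_zero_of_addv W hf hadd) hC₀ (hPI f hf) (by omega) hn hunit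
  have h := padicVal_identity_of_tameBranchRatDvdAt_of_cert hT hp2 hadd (Or.inr hGord) hf hord hã hB
    hint1 ⟨1, by rw [hrk], hunit'⟩ hBcl hκ hγ hcv D hchar
  rw [hrk] at h
  obtain ⟨hS, hfin, hlam, ℓ, hℓ, hna, hid⟩ := h
  exact ⟨hS, hfin, hlam, ℓ, hℓ, hna, by exact_mod_cast hid⟩

/-! #### The same with the typed Kato half DISCHARGED by Delbourgo 2002 (C) (A227) -/

/-- **λ-certificate from PRINTED facts + the two per-pair inputs** (X4-3 locus, `p ≥ 5`, non-CM):
Delbourgo 2002 (A) (`hDel`, and its (M)-twin `hDelM`, needed only to state the Kato half on the whole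
locus) + (C) (`hC`, A227) discharge `TameBranchRatDvdAt W p` (`tameBranchRatDvdAt_of_thmC`); with
`PlusSymbolsPIntegralAt`, boundedness of the forced partner and `‖RS k n‖ = 1` (`k < p`, `n ≥ 1`):
`CharLamLeAt W p k`. [cite: Delbourgo2002, Theorem (A), (C) (p. 40)] [cite: SteinWuthrich2013, §3] -/
theorem charLamLeAt_of_thmC_of_forcedRiemannSum (hC : Delbourgo2002.thmC_charIdeal_dvd_tameBranch)
    (hDel : Delbourgo2002.mainTheorem) (hDelM : Delbourgo2002.mainTheorem_potMult)
    (hPI : PlusSymbolsPIntegralAt W p) (h5 : 5 ≤ p) (hcm : ¬ W.HasCM) (hadd : Addv W p)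
    (hG : SubGord W p) (he : semistabilityIndex W p ∈ ({3, 4, 6} : Finset ℕ)) (hf : IsNewformOf W f)
    (hχ : CensusX43.IsTeichmullerPow χ (CensusX43.ordinaryTeichmullerExponent W p)) (hã : ‖ã‖ = 1)
    {C₀ : ℝ}
    (hC₀ : ∀ s, ‖TwistPartner.forced χ (fun r ↦ ((ratPlusSymbol f r : ℚ) : ℚ_[p])) ã s‖ ≤ C₀)
    {k n : ℕ} (hk : k < p) (hn : 1 ≤ n) (hunit : ‖RS k n‖ = 1) : CharLamLeAt W p k :=
  charLamLeAt_of_tameBranchRatDvdAt_of_forcedRiemannSum hRS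
    (tameBranchRatDvdAt_of_thmC hC hDel hDelM h5 hcm) hPI h5 hadd hG he hf hχ hã hC₀ hk hn hunit

/-- **X4-3 locus, `ord_{s=1} L(E,s) = 1`, non-CM: Schneider for Delbourgo's datum from PRINTED facts
(Delbourgo 2002 (A), (B), (C); GZK) + `PlusSymbolsPIntegralAt` + boundedness of the forced partner +
ONE unit Riemann sum.** What remains typed per pair on defect 3, 4, 6 at rank one: Manin–Drinfeld for
`f̃` (the bound `C₀`), integrality of the plus symbols, and the finite inequality — the last a
decidable statement about `E`'s symbols. Nothing booked; X3♯(G-ord)/X4♯(G-ord) CONSTRUCTION-SHAPED.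
[cite: Delbourgo2002, Theorem (A), (B), (C) (p. 40)] [cite: SteinWuthrich2013, §3] -/
theorem exists_schneider_rankOne_of_thmC_of_forcedRiemannSum
    (hC : Delbourgo2002.thmC_charIdeal_dvd_tameBranch) (hDel : Delbourgo2002.mainTheorem)
    (hDelM : Delbourgo2002.mainTheorem_potMult) (hGZK : rank_eq_analyticRank_of_analyticRank_le_one)
    (hPI : PlusSymbolsPIntegralAt W p) (h5 : 5 ≤ p) (hcm : ¬ W.HasCM) (hadd : Addv W p)
    (hG : SubGord W p) (he : semistabilityIndex W p ∈ ({3, 4, 6} : Finset ℕ))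
    (hr : W.analyticRank = 1) (hf : IsNewformOf W f)
    (hχ : CensusX43.IsTeichmullerPow χ (CensusX43.ordinaryTeichmullerExponent W p)) (hã : ‖ã‖ = 1)
    {C₀ : ℝ}
    (hC₀ : ∀ s, ‖TwistPartner.forced χ (fun r ↦ ((ratPlusSymbol f r : ℚ) : ℚ_[p])) ã s‖ ≤ C₀)
    {n : ℕ} (hn : 1 ≤ n) (hunit : ‖RS 1 n‖ = 1) :
    (∀ Dh : PAdicHeightData W p, LeadingTermClauses W p Dh → SchneiderConjecture Dh) ∧
      ∃ Dh : PAdicHeightData W p, LeadingTermClauses W p Dh ∧ SchneiderConjecture Dh :=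
  exists_schneider_rankOne_of_tameBranchRatDvdAt_of_forcedRiemannSum hRS hDel hGZK
    (tameBranchRatDvdAt_of_thmC hC hDel hDelM h5 hcm) hPI h5 hcm hadd hG he hr hf hχ hã hC₀ hn hunit

end Curve

end Summit.BirchSwinnertonDyer.Rank1Residual.Additive

end
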